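import Mathlib
import Summits.MatrixMultiplication.MatrixMultiplication.Theorems.LevelGradedCohnUmansGradedDesignFamilyStubSubfieldCellModP
import Summits.MatrixMultiplication.MatrixMultiplication.Theorems.LevelGradedCohnUmansGradedDesignFamilyStubSubfieldCellDuality

/-!
# Mod-`p` dual certificates for subfield-cell designs (design-certificate helper)

Route `LevelGradedCohnUmans`, crux `GradedDesignFamily` (stmt-MatrixMultiplication-7610), registered line
`Cruxes/GradedDesignFamily/Lines/quadratic_extension_level_one_cell.lean`, stub S3 `stub_subfieldCell`
(cell dossier `SUBFIELD.md` §10.5–§11).  Third piece of the *duality certificate* infrastructure, and the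
one that makes large TRUE finite instances of the stub's inner clause Lean-sized WITHOUT any elimination in
the kernel and WITHOUT rational data:

* `exists_rat_duals_of_zmod_duals` — if every point `g₀` of a finite point set has a frame table over
  `ZMod p` whose evaluations `g ↦ ∑_{u ∈ S} b(u, g·u)` are `[g = g₀]` (a *dual vector* = right-inverse
  column of the 0/1 evaluation system mod `p`), then the rows are independent mod `p`, hence over `ℚ`
  (`linearIndependent_rat_of_zmod`), hence the system has full row rank and EVERY point has a RATIONAL
  dual table (`exists_mulVec_eq_of_leftKernel` with an empty left-kernel basis).
* `subfieldCell_pack_modp` — the packaging for the subfield cell `φ = mapGL : SL₂(k) → GL₂(K)`: explicit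
  lists `Y`, `Z`, all of `SL₂(k)`, one representative `r_c` per `φ(SL₂ k)`-coset of the point set
  `φ(SL₂ k)·(Y Y⁻¹ Z)`, a cover hypothesis, target well-formedness, and ONE mod-`p` dual table per coset
  representative (the duals of the other points are its `φ(SL₂ k)`-translates) give the inner clause of
  `stub_subfieldCell` with `|Y| = ny`, `|Z| = nz`, `|K| = NK`.

The data a witness file then carries is `#cosets × |S| × |K|²` residues mod a one-digit prime instead of
rational separators of several-hundred-bit height.  Pure algebra; certificate infrastructure for finite
instances — VALUE = theorem / certificate format, NOT summit progress (the stub itself is asymptotic and is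
decided by none of this).
-/

namespace Summit.MatrixMultiplication.MatrixMultiplication.Theorems.GradedDesignFamily

open Matrix

/-- **Dual vectors mod `p` give dual vectors over `ℚ`.**  Points `g ∈ Pt` act on vectors by `act`;
a *frame table* `f` is evaluated at `g` as `∑ u ∈ S, f u (act g u)`.  If every point `g₀` has a
table over `ZMod p` whose evaluations are `[g = g₀]` (a dual / right-inverse vector of the 0/1
evaluation system mod `p`), then the rows of the system are linearly independent mod `p`, hence over
`ℚ`, hence the system has full row rank and every point has a RATIONAL dual table. -/
theorem exists_rat_duals_of_zmod_duals {α V : Type*} [Fintype V] [DecidableEq V] [DecidableEq α]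
    (act : α → V → V) (Pt : Finset α) (S : Finset V) {p : ℕ} [Fact p.Prime]
    (hdual : ∀ g₀ ∈ Pt, ∃ b : V → V → ZMod p, ∀ g ∈ Pt,
      (∑ u ∈ S, b u (act g u)) = if g = g₀ then 1 else 0) :
    ∀ g₀ ∈ Pt, ∃ x : V → V → ℚ, ∀ g ∈ Pt,
      (∑ u ∈ S, x u (act g u)) = if g = g₀ then 1 else 0 := by
  classical
  -- integer 0/1 rows indexed by the points, columns `(u, v)`
  let w : ↥Pt → (V × V) → ℤ := fun g uv => if uv.1 ∈ S ∧ act g uv.1 = uv.2 then 1 else 0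
  -- pairing a row with a table gives the frame evaluation
  have key : ∀ {R : Type} [CommRing R] (f : V → V → R) (g : ↥Pt),
      (∑ uv : V × V, ((w g uv : ℤ) : R) * f uv.1 uv.2) = ∑ u ∈ S, f u (act g u) := by
    intro R _ f g
    rw [Fintype.sum_prod_type]
    have hin : ∀ u : V, (∑ v : V, ((w g (u, v) : ℤ) : R) * f u v)
        = if u ∈ S then f u (act g u) else 0 := by
      intro u
      by_cases hu : u ∈ S
      · simp only [w, hu, true_and, Int.cast_ite, Int.cast_one, Int.cast_zero, ite_mul, one_mul,
          zero_mul, if_true]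
        rw [Finset.sum_ite_eq]
        simp
      · simp [w, hu]
    simp_rw [hin]
    rw [Finset.sum_ite_mem, Finset.univ_inter]
  -- independence of the rows mod p
  have hind : LinearIndependent (ZMod p) (fun g uv => ((w g uv : ℤ) : ZMod p)) := by
    rw [Fintype.linearIndependent_iff]
    intro c hc g₀
    obtain ⟨b, hb⟩ := hdual g₀ g₀.2
    have h1 := congrArg (fun f : (V × V) → ZMod p => ∑ uv, f uv * b uv.1 uv.2) hc
    simp only [Finset.sum_apply, Pi.smul_apply, smul_eq_mul, Pi.zero_apply, zero_mul,
      Finset.sum_const_zero, Finset.sum_mul] at h1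
    rw [Finset.sum_comm] at h1
    have h2 : ∀ g : ↥Pt, (∑ uv : V × V, c g * (((w g uv : ℤ)) : ZMod p) * b uv.1 uv.2)
        = c g * (if (g : α) = g₀ then 1 else 0) := by
      intro g
      rw [← hb g g.2, ← key b g, Finset.mul_sum]
      refine Finset.sum_congr rfl fun uv _ => ?_
      ring
    simp_rw [h2] at h1
    simp_rw [Subtype.coe_inj (a := _) ] at h1
    simpa using h1
  have hindQ := linearIndependent_rat_of_zmod w hind
  let M : Matrix ↥Pt (V × V) ℚ := fun g uv => ((w g uv : ℤ) : ℚ)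
  have hrank : M.rank = Fintype.card ↥Pt := LinearIndependent.rank_matrix hindQ
  intro g₀ hg₀
  let e : ↥Pt → ℚ := fun g => if (g : α) = g₀ then 1 else 0
  obtain ⟨x, hx⟩ := exists_mulVec_eq_of_leftKernel M e (fun _ : Fin 0 => (0 : ↥Pt → ℚ))
    (by simp [hrank]) linearIndependent_empty_type (fun i => i.elim0) (fun i => i.elim0)
  refine ⟨fun u v => x (u, v), fun g hg => ?_⟩
  have h3 := congr_fun hx ⟨g, hg⟩
  simp only [Matrix.mulVec, dotProduct, M, e] at h3
  rw [key (fun u v => x (u, v)) ⟨g, hg⟩] at h3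
  exact h3


/-- **Packaging lemma (mod-`p` dual certificates)** for finite instances of the subfield-cell clause of
`stub_subfieldCell`, for ANY finite fields `k ⊂ K` with `|K| = |k|²` and `φ = mapGL`: indexed units `yOf`,
`zOf`, a list `slOf` exhausting `SL₂(k)`, representatives `rOf` of the `φ(SL₂ k)`-cosets making up the point
set `P = φ(SL₂ k)·(Y Y⁻¹ Z)` (`hcov`), well-formedness of the targets (`hwf`: a point equals a target only
in the designated way) and, for every representative `r_c`, a frame table `b_c` over `ZMod p` on the finset
`S` whose evaluations on `P` are `[g = r_c]` (`hdual`; product matrix bound once by `let`).  Then the rows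
of the 0/1 evaluation system are independent mod `p` (the duals of the other points are `φ(SL₂ k)`-translates
of the `b_c`), hence over `ℚ` (`linearIndependent_rat_of_zmod`), the system has full row rank, every target
has a rational frame separator (`exists_mulVec_eq_of_leftKernel`), and the clause holds with `Y = range yOf`,
`Z = range zOf`.  Pure bookkeeping + linear algebra; certificate use only, NOT summit progress. -/
theorem subfieldCell_pack_modp {k K : Type} [Field k] [Fintype k] [DecidableEq k]
    [Field K] [Fintype K] [DecidableEq K] [Algebra k K]
    (hcard : Fintype.card K = Fintype.card k ^ 2) {NK : ℕ} (hNK : Fintype.card K = NK)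
    {ny nz m nc : ℕ} {p : ℕ} [Fact p.Prime]
    (yOf : Fin ny → GL (Fin 2) K) (zOf : Fin nz → GL (Fin 2) K)
    (slOf : Fin m → Matrix.SpecialLinearGroup (Fin 2) k) (rOf : Fin nc → GL (Fin 2) K)
    (S : Finset (Fin 2 → K))
    (hy : Function.Injective yOf) (hz : Function.Injective zOf)
    (hsl : ∀ a : Matrix.SpecialLinearGroup (Fin 2) k, ∃ n : Fin m, slOf n = a)
    (hcov : ∀ i i' : Fin ny, ∀ l : Fin nz, ∃ c : Fin nc, ∃ n' : Fin m,
        Matrix.SpecialLinearGroup.mapGL K (slOf n') * rOf c = yOf i * (yOf i')⁻¹ * zOf l)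
    (hwf : ∀ n : Fin m, ∀ i i' : Fin ny, ∀ l j : Fin nz,
        Matrix.SpecialLinearGroup.mapGL K (slOf n) * yOf i * (yOf i')⁻¹ * zOf l = zOf j →
        slOf n = 1 ∧ yOf i = yOf i' ∧ zOf l = zOf j)
    (hdual : ∀ c : Fin nc, ∃ b : (Fin 2 → K) → (Fin 2 → K) → ZMod p,
        ∀ n' : Fin m, ∀ c' : Fin nc,
          (let X : Matrix (Fin 2) (Fin 2) K :=
              ((Matrix.SpecialLinearGroup.mapGL K (slOf n') * rOf c' : GL (Fin 2) K) :
                Matrix (Fin 2) (Fin 2) K)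
            let x₀₀ : K := X 0 0
            let x₀₁ : K := X 0 1
            let x₁₀ : K := X 1 0
            let x₁₁ : K := X 1 1
            ∑ u ∈ S, b u (!![x₀₀, x₀₁; x₁₀, x₁₁].mulVec u)) =
            if Matrix.SpecialLinearGroup.mapGL K (slOf n') * rOf c' = rOf c then 1 else 0) :
    ∃ (k K : Type) (_ : Field k) (_ : Fintype k) (_ : DecidableEq k)
      (_ : Field K) (_ : Fintype K) (_ : DecidableEq K)
      (φ : Matrix.SpecialLinearGroup (Fin 2) k →* Matrix.GeneralLinearGroup (Fin 2) K),
      Function.Injective φ ∧ Fintype.card K = Fintype.card k ^ 2 ∧ Fintype.card K = NK ∧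
      ∃ Y Z : Finset (Matrix.GeneralLinearGroup (Fin 2) K),
        Y.card = ny ∧ Z.card = nz ∧
        ∀ z₀ ∈ Z, ∃ cf : (Fin 2 → K) → (Fin 2 → K) → ℂ,
          ∀ a : Matrix.SpecialLinearGroup (Fin 2) k, ∀ y ∈ Y, ∀ y' ∈ Y, ∀ z ∈ Z,
            (∑ u : Fin 2 → K, cf u (((φ a * y * y'⁻¹ * z : Matrix.GeneralLinearGroup (Fin 2) K) :
                Matrix (Fin 2) (Fin 2) K).mulVec u)) =
              if a = 1 ∧ y = y' ∧ z = z₀ then 1 else 0 := by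
  classical
  set ψ := Matrix.SpecialLinearGroup.mapGL (n := Fin 2) (R := k) K with hψ
  refine ⟨k, K, inferInstance, inferInstance, inferInstance, inferInstance, inferInstance, inferInstance,
    ψ, ?_, hcard, hNK, Finset.univ.image yOf, Finset.univ.image zOf, ?_, ?_, ?_⟩
  · intro a a' h
    have h' := congrArg (fun w : GL (Fin 2) K => (w : Matrix (Fin 2) (Fin 2) K)) h
    simp only [hψ, Matrix.SpecialLinearGroup.mapGL_coe_matrix] at h'
    exact Subtype.ext (Matrix.map_injective (algebraMap k K).injective h')
  · rw [Finset.card_image_of_injective _ hy]; simp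
  · rw [Finset.card_image_of_injective _ hz]; simp
  -- the point set and the action on vectors
  let π : Fin m × Fin nc → GL (Fin 2) K := fun nc' => ψ (slOf nc'.1) * rOf nc'.2
  let Pt : Finset (GL (Fin 2) K) := Finset.univ.image π
  let act : GL (Fin 2) K → (Fin 2 → K) → (Fin 2 → K) :=
    fun g u => (g : Matrix (Fin 2) (Fin 2) K).mulVec u
  have hmemPt : ∀ n' c', ψ (slOf n') * rOf c' ∈ Pt := fun n' c' =>
    Finset.mem_image.mpr ⟨(n', c'), Finset.mem_univ _, rfl⟩
  -- plain form of the dual identities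
  have hdual' : ∀ c : Fin nc, ∃ b : (Fin 2 → K) → (Fin 2 → K) → ZMod p, ∀ n' c',
      (∑ u ∈ S, b u (act (ψ (slOf n') * rOf c') u)) =
        if ψ (slOf n') * rOf c' = rOf c then 1 else 0 := by
    intro c
    obtain ⟨b, hb⟩ := hdual c
    refine ⟨b, fun n' c' => ?_⟩
    have hb' := hb n' c'
    dsimp only at hb'
    rw [← Matrix.eta_fin_two] at hb'
    exact hb'
  -- products of listed elements of SL₂(k) are listed
  have hmul : ∀ a : Matrix.SpecialLinearGroup (Fin 2) k, ∀ n' : Fin m, ∃ n'' : Fin m,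
      ψ (slOf n'') = ψ a * ψ (slOf n') := by
    intro a n'
    obtain ⟨n'', hn''⟩ := hsl (a * slOf n')
    exact ⟨n'', by rw [hn'', map_mul]⟩
  -- every point has a mod-p dual table (translate the representative's table)
  have hdualPt : ∀ g₀ ∈ Pt, ∃ b : (Fin 2 → K) → (Fin 2 → K) → ZMod p, ∀ g ∈ Pt,
      (∑ u ∈ S, b u (act g u)) = if g = g₀ then 1 else 0 := by
    intro g₀ hg₀
    obtain ⟨⟨n₀, c₀⟩, -, rfl⟩ := Finset.mem_image.mp hg₀
    obtain ⟨b₀, hb₀⟩ := hdual' c₀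
    refine ⟨fun u v => b₀ u ((((ψ (slOf n₀))⁻¹ : GL (Fin 2) K) : Matrix (Fin 2) (Fin 2) K).mulVec v),
      fun g hg => ?_⟩
    obtain ⟨⟨n', c'⟩, -, rfl⟩ := Finset.mem_image.mp hg
    obtain ⟨n'', hn''⟩ := hmul (slOf n₀)⁻¹ n'
    have hact : ∀ u, (((ψ (slOf n₀))⁻¹ : GL (Fin 2) K) : Matrix (Fin 2) (Fin 2) K).mulVec
        (act (π (n', c')) u) = act (ψ (slOf n'') * rOf c') u := by
      intro u
      simp only [act, π, Matrix.mulVec_mulVec, hn'', map_inv, Units.val_mul, Matrix.coe_units_inv,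
        mul_assoc]
    simp_rw [hact, hb₀ n'' c']
    have hiff : ψ (slOf n'') * rOf c' = rOf c₀ ↔ π (n', c') = π (n₀, c₀) := by
      simp only [π, hn'', map_inv]
      rw [mul_assoc, inv_mul_eq_iff_eq_mul]
    simp only [hiff]
  -- rational dual tables for every point (full row rank transported from `ZMod p` to `ℚ`)
  have hrat := exists_rat_duals_of_zmod_duals act Pt S hdualPt
  -- the clause
  intro z₀ hz₀
  obtain ⟨j, -, rfl⟩ := Finset.mem_image.mp hz₀
  rcases Nat.eq_zero_or_pos ny with hny | hny
  · subst hny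
    refine ⟨fun _ _ => 0, ?_⟩
    intro a y hy₁
    obtain ⟨i, -, -⟩ := Finset.mem_image.mp hy₁
    exact i.elim0
  obtain ⟨c₀, n₀, hz0⟩ := hcov ⟨0, hny⟩ ⟨0, hny⟩ j
  have hzPt : zOf j ∈ Pt := by
    rw [mul_inv_cancel, one_mul] at hz0
    rw [← hz0]; exact hmemPt n₀ c₀
  obtain ⟨x, hx⟩ := hrat (zOf j) hzPt
  refine ⟨fun u v => if u ∈ S then (x u v : ℂ) else 0, ?_⟩
  intro a y hy₁ y' hy₂ z hz₁
  obtain ⟨i, -, rfl⟩ := Finset.mem_image.mp hy₁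
  obtain ⟨i', -, rfl⟩ := Finset.mem_image.mp hy₂
  obtain ⟨l, -, rfl⟩ := Finset.mem_image.mp hz₁
  obtain ⟨n, rfl⟩ := hsl a
  -- the point of this tuple lies in `Pt`
  obtain ⟨c, n', hcn⟩ := hcov i i' l
  obtain ⟨n'', hn''⟩ := hmul (slOf n) n'
  have hXPt : ψ (slOf n) * yOf i * (yOf i')⁻¹ * zOf l ∈ Pt := by
    have : ψ (slOf n) * yOf i * (yOf i')⁻¹ * zOf l = ψ (slOf n'') * rOf c := by
      rw [hn'', mul_assoc (ψ (slOf n)) (ψ (slOf n')), hcn]; simp only [mul_assoc]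
    rw [this]; exact hmemPt n'' c
  have hxX := hx _ hXPt
  simp only [Finset.sum_ite_mem, Finset.univ_inter]
  have hcast : (∑ u ∈ S, (x u (act (ψ (slOf n) * yOf i * (yOf i')⁻¹ * zOf l) u) : ℂ)) =
      ((if ψ (slOf n) * yOf i * (yOf i')⁻¹ * zOf l = zOf j then (1 : ℚ) else 0 : ℚ) : ℂ) := by
    rw [← hxX]; push_cast; rfl
  have hiff : ψ (slOf n) * yOf i * (yOf i')⁻¹ * zOf l = zOf j ↔
      slOf n = 1 ∧ yOf i = yOf i' ∧ zOf l = zOf j := by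
    constructor
    · exact hwf n i i' l j
    · rintro ⟨h1, h2, h3⟩
      rw [h1, h2, h3, map_one, one_mul, mul_inv_cancel, one_mul]
  change (∑ u ∈ S, (x u (act (ψ (slOf n) * yOf i * (yOf i')⁻¹ * zOf l) u) : ℂ)) = _
  rw [hcast]
  by_cases hc : slOf n = 1 ∧ yOf i = yOf i' ∧ zOf l = zOf j
  · rw [if_pos (hiff.mpr hc), if_pos hc]; simp
  · rw [if_neg (fun h => hc (hiff.mp h)), if_neg hc]; simp

end Summit.MatrixMultiplication.MatrixMultiplication.Theorems.GradedDesignFamily
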